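import Summits.ResolutionOfSingularities.ResolutionOfSingularities.Theorems.WeightedInvariantEssSmoothMonomialTypeDescent
import HarnessLib

/-!
# Dimension bookkeeping of the restricted compatibility clause (c11)↾≤2: `dim S ≤ dim S' ≤ 2`, the relative-dimension-zero
# case `𝔪S' = 𝔪'`, monomial type in dimension ≤ 1, and the monomial-type iff under the clause's own binders
# (door `HypersurfaceCentreConstruction`, stmt-ResolutionOfSingularities-19897, rung P2, (o24-C))

Topic: `Summits/ResolutionOfSingularities/ResolutionOfSingularities/Theorems`. Helper for the door item
`HypersurfaceCentreConstruction` (statement `stmt-ResolutionOfSingularities-19897`, route `WeightedInvariant`), line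
`local-engine` of res-L1-w43-plan-1 (L W4.3), KEY-RUNG P2 (`stub_keyRung_dimLETwo`, skeleton v3.6), conjunct (c11)↾≤2
`IotaJEssSmoothCompatibleLE2 iotaOrd jContact` (holder res-type-078). After-care sibling BY NAME of res-type-078's
`…EssSmoothMonomialTypeDescent` (p517017: `EssSmoothDescent.isMonomialType_of_map (h𝔪 : 𝔪S' = 𝔪') (hdim : dim S = 2)
(hdim' : dim S' = 2)`): this file derives those three hypotheses from the clause's single binder `ringKrullDim S' ≤ 2`,
so the (o24-C) assembly can split on `IsMonomialType f` without re-deriving dimensions. res-type-073 (P2 assembler).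

[OURS · L1 W4.3] Replaces the role of NO printed item; NOT a statement of the manuscript under review
(Hironaka 2017, [claim: Hironaka2017, status: under-review]). AI work, weaker than expert review. Kernel lemmas only.

## What is proved (binders verbatim those of `IotaJEssSmoothCompatibleLE2`: `S → S'` local, formally smooth,
## essentially of finite type, `S`, `S'` regular local)

* `exists_dims` — `dim S' = dim S + dim (S'/𝔪S')` in `ℕ` (tree `Resolution.ringKrullDim_eq_add_of_flat`; flatness from
  res-type-039's `IotaOrderEssSmooth.flat_of_formallySmooth_of_essFiniteType`).
* `map_maximalIdeal_eq_of_ringKrullDim_eq` — relative dimension zero: `dim S = dim S'` ⇒ `𝔪S' = 𝔪'` (the closed fibre is a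
  regular local ring of dimension `0`, i.e. a field; `IotaOrderEssSmooth.isRegularLocalRing_fibre_of_formallySmooth`).
* `isMonomialType_of_ringKrullDim_le_one` — in a regular local ring of dimension `≤ 1` every non-zero non-unit is `u·pᵃ`
  with `p ∈ 𝔪 ∖ 𝔪²` (any regular local ring; no map).
* `dims_of_not_isMonomialType` — under `ringKrullDim S' ≤ 2`, a non-zero non-unit `f ∈ S` NOT of monomial type forces
  `dim S = 2`, `dim S' = 2` and `𝔪S' = 𝔪'` — exactly the hypotheses of `EssSmoothDescent.isMonomialType_of_map` /
  `eq_one_of_associated_pow`.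
* `isMonomialType_algebraMap_iff` — under `ringKrullDim S' ≤ 2`, for a non-zero non-unit `f`:
  `IsMonomialType (φ f) ↔ IsMonomialType f` (078's ascent + descent + the bookkeeping above).
* `isRegularLocalRing_localization_quotient_under` — for the record, the general PRIME-PAIR FIBRE regularity behind
  078's §3: for ANY `S`-algebra `S'` formally smooth and essentially of finite type and ANY prime `P'` of `S'`,
  `S'_{P'} ⧸ (P' ∩ S)·S'_{P'}` is a regular local ring (plumbing of the tree's `Grothendieck1967_17_5_8_holds`).

## References

* H. Matsumura, *Commutative Ring Theory*, Thm. 15.1 (dimension formula for flat local maps), Thm. 23.7.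
  [cite: Matsumura1987, Thm. 15.1]
* A. Grothendieck, EGA IV₄, Prop. 17.5.8 (iii). [Grothendieck1967]
-/

noncomputable section

open IsLocalRing Literature.AlgebraicGeometry.Resolution
open scoped TensorProduct

set_option linter.dupNamespace false -- mandated namespace of this single-conjunct summit

namespace Summit.ResolutionOfSingularities.ResolutionOfSingularities.Cruxes.HypersurfaceCentreConstruction.LocalEngine

namespace EssSmoothLE2

open Summit.ResolutionOfSingularities.ResolutionOfSingularities.Theorems

universe u

/-! ## The prime-pair fibres of a formally smooth, essentially-of-finite-type algebra are regular -/

/-- **Regular prime-pair fibres.** For `S'` formally smooth and essentially of finite type over `S` and a prime `P'` of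
`S'` over `P = P' ∩ S`, the local ring `S'_{P'} ⧸ P·S'_{P'}` is regular: `S_P → S'_{P'}` is local, formally smooth and
essentially of finite type, and its closed fibre `k(P) ⊗_{S_P} S'_{P'} ≅ S'_{P'} ⧸ P·S'_{P'}` is formally smooth and
essentially of finite type over the field `k(P)`, hence regular (tree
`Resolution.isRegularLocalRing_of_formallySmooth_of_essFiniteType`). [cite: Grothendieck1967, Prop. 17.5.8 (iii) (PDF p. 69)] -/
theorem isRegularLocalRing_localization_quotient_under (S S' : Type u) [CommRing S] [CommRing S']
    [Algebra S S'] [Algebra.FormallySmooth S S'] [Algebra.EssFiniteType S S'] (P' : Ideal S') [P'.IsPrime] :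
    IsRegularLocalRing
      (Localization.AtPrime P' ⧸ (P'.under S).map (algebraMap S (Localization.AtPrime P'))) := by
  haveI : P'.LiesOver (P'.under S) := ⟨rfl⟩
  letI : Algebra (Localization.AtPrime (P'.under S)) (Localization.AtPrime P') :=
    Localization.AtPrime.algebraOfLiesOver (P'.under S) P'
  haveI : IsLocalHom (algebraMap (Localization.AtPrime (P'.under S)) (Localization.AtPrime P')) := by
    rw [Localization.AtPrime.IsLiesOverAlgebra.algebraMap_eq (p := P'.under S) (P := P')]
    infer_instance
  haveI : Algebra.FormallySmooth (Localization.AtPrime (P'.under S)) (Localization.AtPrime P') :=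
    Algebra.FormallySmooth.localization_base (P'.under S).primeCompl
  haveI : Algebra.EssFiniteType S (Localization.AtPrime P') :=
    Algebra.EssFiniteType.comp S S' (Localization.AtPrime P')
  haveI : Algebra.EssFiniteType (Localization.AtPrime (P'.under S)) (Localization.AtPrime P') :=
    Algebra.EssFiniteType.of_comp S (Localization.AtPrime (P'.under S)) (Localization.AtPrime P')
  haveI : IsRegularLocalRing
      (ResidueField (Localization.AtPrime (P'.under S)) ⊗[Localization.AtPrime (P'.under S)]
        Localization.AtPrime P') :=
    isRegularLocalRing_of_formallySmooth_of_essFiniteType (ResidueField (Localization.AtPrime (P'.under S))) _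
  let e : ResidueField (Localization.AtPrime (P'.under S)) ⊗[Localization.AtPrime (P'.under S)]
        Localization.AtPrime P' ≃+*
      Localization.AtPrime P' ⧸ (maximalIdeal (Localization.AtPrime (P'.under S))).map
        (algebraMap (Localization.AtPrime (P'.under S)) (Localization.AtPrime P')) :=
    (Algebra.TensorProduct.comm (Localization.AtPrime (P'.under S))
        (ResidueField (Localization.AtPrime (P'.under S))) (Localization.AtPrime P')).toRingEquiv.trans
      (Algebra.TensorProduct.quotIdealMapEquivTensorQuot (Localization.AtPrime P')
        (maximalIdeal (Localization.AtPrime (P'.under S)))).toRingEquiv.symm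
  have hI : (maximalIdeal (Localization.AtPrime (P'.under S))).map
        (algebraMap (Localization.AtPrime (P'.under S)) (Localization.AtPrime P')) =
      (P'.under S).map (algebraMap S (Localization.AtPrime P')) := by
    rw [← Localization.AtPrime.map_eq_maximalIdeal, Ideal.map_map,
      ← IsScalarTower.algebraMap_eq S (Localization.AtPrime (P'.under S)) (Localization.AtPrime P')]
  rw [← hI]
  exact IsRegularLocalRing.of_ringEquiv e

/-! ## Monomial type in Krull dimension ≤ 1 (any regular local ring) -/

/-- In a regular local ring of Krull dimension `≤ 1` (a field or a discrete valuation ring) every non-zero non-unit is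
of monomial type: a prime factor `p` of `f` generates the (height-one) maximal ideal, so `p ∉ 𝔪² = (p²)` and
`f = pᵃ·u` with `p ∤ u`, i.e. `u` a unit. [cite: Matsumura1987, Thm. 20.3] -/
theorem isMonomialType_of_ringKrullDim_le_one {S : Type u} [CommRing S] [IsRegularLocalRing S]
    (hdim : ringKrullDim S ≤ 1) {f : S} (hf0 : f ≠ 0) (hfu : ¬ IsUnit f) : IsMonomialType f := by
  classical
  haveI := isDomain_of_isRegularLocalRing S
  haveI : UniqueFactorizationMonoid S := IsRegularLocalRing.uniqueFactorizationMonoid S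
  obtain ⟨p, hpirr, -⟩ := WfDvdMonoid.exists_irreducible_factor hfu hf0
  have hp : Prime p := hpirr.prime
  haveI hPp : (Ideal.span {p}).IsPrime := (Ideal.span_singleton_prime hp.ne_zero).mpr hp
  have hp𝔪 : p ∈ maximalIdeal S := (IsLocalRing.mem_maximalIdeal p).mpr (mem_nonunits_iff.mpr hp.not_unit)
  -- `(p) = 𝔪`: a non-zero prime of a local domain of dimension `≤ 1`
  have hspan : Ideal.span {p} = maximalIdeal S := by
    have hle : Ideal.span {p} ≤ maximalIdeal S := (Ideal.span_singleton_le_iff_mem _).mpr hp𝔪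
    refine eq_of_le_of_not_lt hle fun hlt => ?_
    have h1 : (Ideal.span {p}).height < (maximalIdeal S).height := Ideal.height_strict_mono_of_isPrime_of_isPrime hlt
    have h2 : ((maximalIdeal S).height : WithBot ℕ∞) ≤ 1 := by
      rw [IsLocalRing.maximalIdeal_height_eq_ringKrullDim]
      exact hdim
    have h2' : (maximalIdeal S).height ≤ 1 := by
      rw [← WithBot.coe_le_coe, WithBot.coe_one]
      exact h2
    have h3 : (Ideal.span {p}).height ≠ 0 := by
      rw [Ne, Ideal.height_eq_zero_iff_eq_bot, Ideal.span_singleton_eq_bot]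
      exact hp.ne_zero
    have hlt1 : (Ideal.span {p}).height < 1 := lt_of_lt_of_le h1 h2'
    exact h3 (Order.lt_one_iff.mp hlt1)
  -- `p ∉ 𝔪² = (p²)`
  have hp2 : p ∉ maximalIdeal S ^ 2 := by
    rw [← hspan, Ideal.span_singleton_pow, Ideal.mem_span_singleton]
    rintro ⟨t, ht⟩
    apply hp.not_unit
    have h1 : p * (1 - p * t) = 0 := by rw [mul_sub, mul_one, ← mul_assoc, ← pow_two, ← ht, sub_self]
    rcases mul_eq_zero.mp h1 with h | h
    · exact absurd h hp.ne_zero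
    · exact IsUnit.of_mul_eq_one t (sub_eq_zero.mp h).symm
  -- `f = pᵃ·u`, `p ∤ u`
  obtain ⟨a, u, hndvd, hfac⟩ := WfDvdMonoid.max_power_factor hf0 hpirr
  have hu : IsUnit u := by
    by_contra hnu
    apply hndvd
    have hu𝔪 : u ∈ maximalIdeal S := (IsLocalRing.mem_maximalIdeal u).mpr (mem_nonunits_iff.mpr hnu)
    rw [← hspan] at hu𝔪
    exact Ideal.mem_span_singleton.mp hu𝔪
  exact ⟨u, p, a, hu, hp𝔪, hp2, by rw [hfac, mul_comm]⟩

/-! ## The clause's binders: dimensions -/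

variable (S S' : Type) [CommRing S] [CommRing S'] [IsRegularLocalRing S] [IsRegularLocalRing S'] [Algebra S S']
  [IsLocalHom (algebraMap S S')] [Algebra.FormallySmooth S S'] [Algebra.EssFiniteType S S']

omit [IsRegularLocalRing S] [IsRegularLocalRing S'] [Algebra.FormallySmooth S S'] [Algebra.EssFiniteType S S'] in
/-- The closed fibre `S' ⧸ 𝔪S'` of a local homomorphism is a non-trivial local ring. [folklore] -/
theorem nontrivial_fibre [IsLocalRing S] [IsLocalRing S'] :
    Nontrivial (S' ⧸ (maximalIdeal S).map (algebraMap S S')) :=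
  Ideal.Quotient.nontrivial_iff.mpr (map_maximalIdeal_ne_top (R := S) (S := S'))

/-- **Dimension formula in `ℕ`.** `dim S' = dim S + dim (S' ⧸ 𝔪S')` (flat local homomorphism of Noetherian local rings;
flatness from formal smoothness + essential finiteness). [cite: Matsumura1987, Thm. 15.1] -/
theorem exists_dims :
    ∃ a b c : ℕ, ringKrullDim S = a ∧ ringKrullDim S' = b ∧
      ringKrullDim (S' ⧸ (maximalIdeal S).map (algebraMap S S')) = c ∧ b = a + c := by
  haveI : Module.Flat S S' := IotaOrderEssSmooth.flat_of_formallySmooth_of_essFiniteType S S'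
  haveI : Nontrivial (S' ⧸ (maximalIdeal S).map (algebraMap S S')) := nontrivial_fibre S S'
  haveI : IsLocalRing (S' ⧸ (maximalIdeal S).map (algebraMap S S')) :=
    IsLocalRing.of_surjective' (Ideal.Quotient.mk _) Ideal.Quotient.mk_surjective
  obtain ⟨a, ha⟩ := exists_ringKrullDim_eq_natCast S
  obtain ⟨b, hb⟩ := exists_ringKrullDim_eq_natCast S'
  obtain ⟨c, hc⟩ := exists_ringKrullDim_eq_natCast (S' ⧸ (maximalIdeal S).map (algebraMap S S'))
  have hformula := ringKrullDim_eq_add_of_flat (R := S) (S := S')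
  rw [ha, hb, hc] at hformula
  refine ⟨a, b, c, ha, hb, hc, ?_⟩
  have h' : ((b : ℕ∞) : WithBot ℕ∞) = ((a + c : ℕ) : ℕ∞) := by
    rw [Nat.cast_add, WithBot.coe_add]
    exact hformula
  exact_mod_cast (WithBot.coe_inj.mp h')

/-- `dim S ≤ dim S'`. [cite: Matsumura1987, Thm. 15.1] -/
theorem ringKrullDim_le : ringKrullDim S ≤ ringKrullDim S' := by
  obtain ⟨a, b, c, ha, hb, -, habc⟩ := exists_dims S S'
  rw [ha, hb]
  exact_mod_cast (habc ▸ Nat.le_add_right a c : a ≤ b)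

/-- **Relative dimension zero ⇒ `𝔪S' = 𝔪'`.** If `dim S = dim S'` then the closed fibre `S' ⧸ 𝔪S'` is a regular local
ring (`IotaOrderEssSmooth.isRegularLocalRing_fibre_of_formallySmooth`) of dimension `0`, i.e. a field, so `𝔪S' = 𝔪'`.
[cite: Matsumura1987, Thm. 15.1 and Thm. 23.7] -/
theorem map_maximalIdeal_eq_of_ringKrullDim_eq (h : ringKrullDim S = ringKrullDim S') :
    (maximalIdeal S).map (algebraMap S S') = maximalIdeal S' := by
  set I := (maximalIdeal S).map (algebraMap S S') with hI
  haveI : Nontrivial (S' ⧸ I) := nontrivial_fibre S S'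
  haveI hreg : IsRegularLocalRing (S' ⧸ I) := IotaOrderEssSmooth.isRegularLocalRing_fibre_of_formallySmooth S S'
  obtain ⟨a, b, c, ha, hb, hc, habc⟩ := exists_dims S S'
  rw [ha, hb] at h
  have hab : a = b := by exact_mod_cast h
  have hc0 : c = 0 := by omega
  -- the maximal ideal of the fibre has `spanFinrank = dim = 0`, hence is `⊥`
  have hsf := hreg.spanFinrank_maximalIdeal
  rw [← hI] at hc
  rw [hc, hc0] at hsf
  have hsf0 : (maximalIdeal (S' ⧸ I)).spanFinrank = 0 := by exact_mod_cast hsf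
  have hbot : maximalIdeal (S' ⧸ I) = ⊥ :=
    Submodule.spanFinrank_eq_zero_iff_eq_bot (IsNoetherian.noetherian _) |>.mp hsf0
  rw [maximalIdeal_quotient_eq_map I, Ideal.map_eq_bot_iff_le_ker, Ideal.mk_ker] at hbot
  exact le_antisymm (map_maximalIdeal_le (algebraMap S S')) hbot

/-- **The non-monomial case lives in relative dimension zero.** Under the clause binder `ringKrullDim S' ≤ 2`, a non-zero
non-unit `f ∈ S` that is NOT of monomial type forces `dim S = 2`, `dim S' = 2` and `𝔪S' = 𝔪'` — the hypotheses of
res-type-078's `EssSmoothDescent.isMonomialType_of_map` / `eq_one_of_associated_pow` (p517017). [OURS · L1 W4.3 · (o24-C)] -/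
theorem dims_of_not_isMonomialType (hdim : ringKrullDim S' ≤ 2) {f : S} (hf0 : f ≠ 0) (hfu : ¬ IsUnit f)
    (hf : ¬ IsMonomialType f) :
    ringKrullDim S = (2 : ℕ) ∧ ringKrullDim S' = (2 : ℕ) ∧
      (maximalIdeal S).map (algebraMap S S') = maximalIdeal S' := by
  obtain ⟨a, b, c, ha, hb, -, habc⟩ := exists_dims S S'
  have hb2 : b ≤ 2 := by
    rw [hb] at hdim
    exact_mod_cast hdim
  have ha1 : ¬ a ≤ 1 := by
    intro ha1
    apply hf
    refine isMonomialType_of_ringKrullDim_le_one ?_ hf0 hfu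
    rw [ha]
    exact_mod_cast ha1
  have ha2 : a = 2 := by omega
  have hb2' : b = 2 := by omega
  refine ⟨by rw [ha, ha2], by rw [hb, hb2'], map_maximalIdeal_eq_of_ringKrullDim_eq S S' (by rw [ha, hb, ha2, hb2'])⟩

/-- **Monomial type under the clause's own binders.** For `S → S'` as in `IotaJEssSmoothCompatibleLE2` with
`ringKrullDim S' ≤ 2` and a non-zero non-unit `f ∈ S`: `φ f` is of monomial type iff `f` is (ascent: 078's
`EssSmoothDescent.isMonomialType_map`, any dimension; descent: `dim S ≤ 1` automatic, else 078's
`EssSmoothDescent.isMonomialType_of_map` with the hypotheses of `dims_of_not_isMonomialType`). [OURS · L1 W4.3 · (o24-C)] -/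
theorem isMonomialType_algebraMap_iff (hdim : ringKrullDim S' ≤ 2) {f : S} (hf0 : f ≠ 0) (hfu : ¬ IsUnit f) :
    IsMonomialType (algebraMap S S' f) ↔ IsMonomialType f := by
  refine ⟨fun h => ?_, fun h => EssSmoothDescent.isMonomialType_map h⟩
  by_contra hf
  obtain ⟨hS, hS', h𝔪⟩ := dims_of_not_isMonomialType S S' hdim hf0 hfu hf
  exact hf (EssSmoothDescent.isMonomialType_of_map h𝔪 hS hS' h)

/-- Contrapositive packaging for the (o24-C) case split: `¬ IsMonomialType f` ⇒ `¬ IsMonomialType (φ f)` together with the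
relative-dimension-zero data. [OURS · L1 W4.3 · (o24-C)] -/
theorem not_isMonomialType_algebraMap (hdim : ringKrullDim S' ≤ 2) {f : S} (hf0 : f ≠ 0) (hfu : ¬ IsUnit f)
    (hf : ¬ IsMonomialType f) :
    ¬ IsMonomialType (algebraMap S S' f) ∧ ringKrullDim S = (2 : ℕ) ∧ ringKrullDim S' = (2 : ℕ) ∧
      (maximalIdeal S).map (algebraMap S S') = maximalIdeal S' :=
  ⟨fun h => hf ((isMonomialType_algebraMap_iff S S' hdim hf0 hfu).mp h), dims_of_not_isMonomialType S S' hdim hf0 hfu hf⟩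

end EssSmoothLE2

end Summit.ResolutionOfSingularities.ResolutionOfSingularities.Cruxes.HypersurfaceCentreConstruction.LocalEngine

end
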